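import Summits.NavierStokesRegularity.NavierStokesRegularity.Theorems.ScenarioCensusRowF1TwoTimeTop
import HarnessLib

/-!
# LINE 34 «two-time-top» port, part 2/4: §3 time signals of an element of `𝒦` — analytic rigidity of rest points, the two CONTRACTION ENGINES, the four KILLS in `𝒦`

Re-homed for the scenario census (typer seat ns-census-typer-1 g9; the cells F1dj / F1gl / F1ge / F1de and the floors are MEMBERS OF RECORD «DECIDED IN KERNEL IN FILES» of row
F1 since census v1.100 (item 70: critic PASS; ref ns-census-ref g13 PRE-CHECK ✓ §18.6; lead-presearch label); this port makes them TREE-decided): VERBATIM PORT of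
ns-idea-3 LINE 34 «two-time-top», `pub/ideators/ns-idea-3/lines/two-time-top/line-two-time-top.lean` sha16 26867eeb269186b0 (1077 l., lean check rc 0, 0 sorry), split
for the 400-line rule into `ScenarioCensusRowF1TwoTimeTop` (§1–§2) → `…TwoTimeTopSignals` (§3) → `…TwoTimeTopTransfer` (§4) → `…TwoTimeTopRows` (§5–§6 + census KEYS).
Lean text VERBATIM in namespace `…Theorems.ScenarioCensus.TwoTimeTop` (the line's `…Cruxes.ScenarioCensusRowF1.TwoTimeTopLine` re-homed); port edits: §2's zoom package /
`tendsto_physicalTime` / `eventually_top` (LINES 15/33 VERBATIM) are taken BY NAME from the landed columnar-top / symmetric-top ports; `@[conjecture]` on the residual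
`PersistenceCollapse` (≡ `ScenarioCensus.Row_F1`, OPEN); docstrings complete.  Statements untouched.

No census VALUE is moved here (row F1 stays OPEN-WITH-LINE; the members become TREE-decided by name); NS regularity is NOT proved; `Row_F1` is untouched (zero
movement, `persistenceCollapse_iff_rowF1`); no summit statement is proved by this file. Lemmas that restate already-landed tree declarations are taken BY NAME (gate lint `dedup.landed`): `exists_singularZoom_package` = `ColumnarTop.exists_singularZoom_package`, `tendsto_physicalTime` = `ColumnarTop.tendsto_physicalTime`, `eventually_top` = `SymmetricTop.eventually_top`.
-/

-- the summit and its single problem share the name `NavierStokesRegularity` (D-0017 nested layout)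
set_option linter.dupNamespace false

noncomputable section

open MeasureTheory Set Function Filter TopologicalSpace Metric
open scoped Topology NNReal ENNReal

namespace Summit.NavierStokesRegularity.NavierStokesRegularity.Theorems.ScenarioCensus.TwoTimeTop

open Literature.Analysis Literature.Analysis.FluidPDE
open Summit.NavierStokesRegularity.NavierStokesRegularity.Theorems
open Summit.NavierStokesRegularity.NavierStokesRegularity.Theses

/-! ## §3 Time signals of an element of `𝒦`: analytic rigidity of rest points, and the two CONTRACTION ENGINES

Everything in this section is about ONE time signal `s ↦ W(s, y)` (`y` fixed) of a Type-I ancient mild solution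
`W ∈ 𝒦_C`: it is real-analytic on the open past (`IsTypeIAncientMild.analyticAt_time`, tree) and obeys
`|W(s, y)| ≤ C/√(−s)`.  No Liouville theorem, no spatial structure and no PDE beyond these two facts is used. -/

/-- The scaled time signal `s ↦ W(κ s, y)` (`κ > 0`) is continuous at every `s < 0`. -/
theorem continuousAt_signal {C : ℝ} {W : ℝ → E3 → E3} (hW : IsTypeIAncientMild C W) (y : E3) {κ : ℝ}
    (hκ : 0 < κ) {s : ℝ} (hs : s < 0) : ContinuousAt (fun r : ℝ => W (κ * r) y) s := by
  have hks : κ * s < 0 := mul_neg_of_pos_of_neg hκ hs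
  have h1 : ContinuousAt (fun σ : ℝ => W σ y) (κ * s) := (hW.analyticAt_time hks y).continuousAt
  have h2 : ContinuousAt (fun r : ℝ => κ * r) s := (continuous_const.mul continuous_id).continuousAt
  exact ContinuousAt.comp (g := fun σ : ℝ => W σ y) h1 h2

/-- **Analytic rigidity of rest points.** If the scaled signal `s ↦ W(κ s, y)` vanishes near one instant `σ < 0`,
the whole signal `W(·, y)` vanishes on the open past (identity theorem on the preconnected `(−∞, 0)`). -/
theorem signal_eq_zero_of_eventually {C : ℝ} {W : ℝ → E3 → E3} (hW : IsTypeIAncientMild C W) (y : E3)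
    {κ : ℝ} (hκ : 0 < κ) {σ : ℝ} (hσ : σ < 0) (hev : ∀ᶠ s in 𝓝 σ, W (κ * s) y = 0) :
    ∀ t < 0, W t y = 0 := by
  have hg : AnalyticOnNhd ℝ (fun s : ℝ => W (κ * s) y) (Iio 0) := by
    intro s hs
    have hks : κ * s < 0 := mul_neg_of_pos_of_neg hκ hs
    have h1 : AnalyticAt ℝ (fun σ : ℝ => W σ y) (κ * s) := hW.analyticAt_time hks y
    have h2 : AnalyticAt ℝ (fun r : ℝ => κ * r) s := analyticAt_const.mul analyticAt_id
    exact AnalyticAt.comp (g := fun σ : ℝ => W σ y) h1 h2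
  have hEq : EqOn (fun s : ℝ => W (κ * s) y) 0 (Iio 0) :=
    hg.eqOn_zero_of_preconnected_of_eventuallyEq_zero isPreconnected_Iio hσ hev
  intro t ht
  have hmem : t / κ ∈ Iio 0 := div_neg_of_neg_of_pos ht hκ
  have h := hEq hmem
  have e : κ * (t / κ) = t := by field_simp
  simp only [Pi.zero_apply, e] at h
  exact h

/-- **Un-anchoring.** A sign condition `0 ≤ G(s)` on a continuous gap function `G`, demanded only at the instants
where the anchor signal `W(a s, y)` is nonzero, holds at EVERY instant of the open past — because near an instant
where it failed the anchor signal would vanish identically near that instant, hence everywhere (rigidity), and the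
condition is assumed to hold for the zero signal. -/
theorem forall_nonneg_of_anchored {C : ℝ} {W : ℝ → E3 → E3} (hW : IsTypeIAncientMild C W) (y : E3)
    {a : ℝ} (ha : 0 < a) {G : ℝ → ℝ} (hG : ∀ s < 0, ContinuousAt G s)
    (h : ∀ s < 0, W (a * s) y ≠ 0 → 0 ≤ G s) (h0 : (∀ t < 0, W t y = 0) → ∀ s < 0, 0 ≤ G s) :
    ∀ s < 0, 0 ≤ G s := by
  intro s hs
  by_contra hlt
  push Not at hlt
  have hT : Tendsto G (𝓝 s) (𝓝 (G s)) := hG s hs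
  have hev1 : ∀ᶠ r in 𝓝 s, G r < 0 := hT.eventually_lt_const hlt
  have hev2 : ∀ᶠ r in 𝓝 s, r < 0 := Iio_mem_nhds hs
  have hzero : ∀ᶠ r in 𝓝 s, W (a * r) y = 0 := by
    filter_upwards [hev1, hev2] with r hr hr0
    by_contra hne
    exact absurd (h r hr0 hne) (not_le.2 hr)
  have hall := signal_eq_zero_of_eventually hW y ha hs hzero
  exact absurd (h0 hall s hs) (not_le.2 hlt)

/-- **ENGINE A — forward contraction to the final time.**  If the time signal of a point of `W ∈ 𝒦_C` contracts
by a ratio `q < 1` over every lag (`√(1+θ)|W((1+θ)s, y)| ≤ q|W(s, y)|` for all `s < 0`), then it vanishes: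
iterating from `t` through `t/(1+θ), t/(1+θ)², … ↑ 0` against the uniform bound `|W(τ, y)| ≤ C/√(−τ)` gives
`|W(t, y)| ≤ qᵏ C/√(−t)` for every `k`. -/
theorem signal_eq_zero_of_forwardContraction {C θ q : ℝ} {W : ℝ → E3 → E3} (hW : IsTypeIAncientMild C W)
    (hθ : 0 < θ) (hq : q < 1) (y : E3)
    (h : ∀ s < 0, Real.sqrt (1 + θ) * ‖W ((1 + θ) * s) y‖ ≤ q * ‖W s y‖) : ∀ t < 0, W t y = 0 := by
  set q' : ℝ := max q 0 with hq'def
  have hq'0 : 0 ≤ q' := le_max_right _ _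
  have hq'1 : q' < 1 := max_lt hq zero_lt_one
  have hκ : 0 < 1 + θ := by linarith
  have hsκ : 0 < Real.sqrt (1 + θ) := Real.sqrt_pos.2 hκ
  have h' : ∀ s < 0, Real.sqrt (1 + θ) * ‖W ((1 + θ) * s) y‖ ≤ q' * ‖W s y‖ := fun s hs =>
    (h s hs).trans (mul_le_mul_of_nonneg_right (le_max_left _ _) (norm_nonneg _))
  have hB : ∀ k : ℕ, ∀ τ < 0, ‖W τ y‖ ≤ q' ^ k * (C / Real.sqrt (-τ)) := by
    intro k
    induction k with
    | zero =>
      intro τ hτ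
      rw [pow_zero, one_mul]
      exact hW.norm_le hτ y
    | succ k ih =>
      intro τ hτ
      have hσ : τ / (1 + θ) < 0 := div_neg_of_neg_of_pos hτ hκ
      have h1 := h' (τ / (1 + θ)) hσ
      have e1 : (1 + θ) * (τ / (1 + θ)) = τ := by field_simp
      rw [e1] at h1
      have h2 := ih _ hσ
      have hnτ : 0 < -τ := neg_pos.2 hτ
      have e2 : Real.sqrt (-(τ / (1 + θ))) = Real.sqrt (-τ) / Real.sqrt (1 + θ) := by
        rw [show -(τ / (1 + θ)) = -τ / (1 + θ) by ring, Real.sqrt_div hnτ.le]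
      rw [e2, div_div_eq_mul_div] at h2
      have hsτ : 0 < Real.sqrt (-τ) := Real.sqrt_pos.2 hnτ
      have key : Real.sqrt (1 + θ) * ‖W τ y‖ ≤
          Real.sqrt (1 + θ) * (q' ^ (k + 1) * (C / Real.sqrt (-τ))) :=
        calc Real.sqrt (1 + θ) * ‖W τ y‖ ≤ q' * ‖W (τ / (1 + θ)) y‖ := h1
          _ ≤ q' * (q' ^ k * (C * Real.sqrt (1 + θ) / Real.sqrt (-τ))) :=
            mul_le_mul_of_nonneg_left h2 hq'0
          _ = Real.sqrt (1 + θ) * (q' ^ (k + 1) * (C / Real.sqrt (-τ))) := by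
            rw [pow_succ]; field_simp
      exact le_of_mul_le_mul_left key hsκ
  intro t ht
  have hlim : Tendsto (fun k : ℕ => q' ^ k * (C / Real.sqrt (-t))) atTop
      (𝓝 (0 * (C / Real.sqrt (-t)))) :=
    (tendsto_pow_atTop_nhds_zero_of_lt_one hq'0 hq'1).mul_const _
  rw [zero_mul] at hlim
  have h0 : ‖W t y‖ ≤ 0 := ge_of_tendsto' hlim fun k => hB k t ht
  exact norm_le_zero_iff.1 h0

/-- **ENGINE B — backward escalation against the Type-I bound.**  If the time signal of a point of `W ∈ 𝒦_C` is
dominated by `q√(1+θ)` times its value one lag earlier (`|W(s, y)| ≤ q√(1+θ)|W((1+θ)s, y)|` for all `s < 0`,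
`q < 1`), then it vanishes: iterating into the past `t, (1+θ)t, (1+θ)²t, …` against `|W(τ, y)| ≤ C/√(−τ)` gives
again `|W(t, y)| ≤ qᵏ C/√(−t)` for every `k`. -/
theorem signal_eq_zero_of_backwardEscalation {C θ q : ℝ} {W : ℝ → E3 → E3} (hW : IsTypeIAncientMild C W)
    (hθ : 0 < θ) (hq : q < 1) (y : E3)
    (h : ∀ s < 0, ‖W s y‖ ≤ q * Real.sqrt (1 + θ) * ‖W ((1 + θ) * s) y‖) : ∀ t < 0, W t y = 0 := by
  set q' : ℝ := max q 0 with hq'def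
  have hq'0 : 0 ≤ q' := le_max_right _ _
  have hq'1 : q' < 1 := max_lt hq zero_lt_one
  have hκ : 0 < 1 + θ := by linarith
  have hsκ : 0 < Real.sqrt (1 + θ) := Real.sqrt_pos.2 hκ
  have h' : ∀ s < 0, ‖W s y‖ ≤ q' * Real.sqrt (1 + θ) * ‖W ((1 + θ) * s) y‖ := fun s hs =>
    (h s hs).trans (mul_le_mul_of_nonneg_right
      (mul_le_mul_of_nonneg_right (le_max_left _ _) hsκ.le) (norm_nonneg _))
  have hB : ∀ k : ℕ, ∀ τ < 0, ‖W τ y‖ ≤ q' ^ k * (C / Real.sqrt (-τ)) := by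
    intro k
    induction k with
    | zero =>
      intro τ hτ
      rw [pow_zero, one_mul]
      exact hW.norm_le hτ y
    | succ k ih =>
      intro τ hτ
      have hσ : (1 + θ) * τ < 0 := mul_neg_of_pos_of_neg hκ hτ
      have h1 := h' τ hτ
      have h2 := ih _ hσ
      have hnτ : 0 < -τ := neg_pos.2 hτ
      have e2 : Real.sqrt (-((1 + θ) * τ)) = Real.sqrt (1 + θ) * Real.sqrt (-τ) := by
        rw [show -((1 + θ) * τ) = (1 + θ) * (-τ) by ring, Real.sqrt_mul hκ.le]
      rw [e2] at h2
      have hsτ : 0 < Real.sqrt (-τ) := Real.sqrt_pos.2 hnτ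
      calc ‖W τ y‖ ≤ q' * Real.sqrt (1 + θ) * ‖W ((1 + θ) * τ) y‖ := h1
        _ ≤ q' * Real.sqrt (1 + θ) * (q' ^ k * (C / (Real.sqrt (1 + θ) * Real.sqrt (-τ)))) :=
          mul_le_mul_of_nonneg_left h2 (mul_nonneg hq'0 hsκ.le)
        _ = q' ^ (k + 1) * (C / Real.sqrt (-τ)) := by
          rw [pow_succ]; field_simp
  intro t ht
  have hlim : Tendsto (fun k : ℕ => q' ^ k * (C / Real.sqrt (-t))) atTop
      (𝓝 (0 * (C / Real.sqrt (-t)))) :=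
    (tendsto_pow_atTop_nhds_zero_of_lt_one hq'0 hq'1).mul_const _
  rw [zero_mul] at hlim
  have h0 : ‖W t y‖ ≤ 0 := ge_of_tendsto' hlim fun k => hB k t ht
  exact norm_le_zero_iff.1 h0

/-! ### The four KILLS in `𝒦` (two-time rigidity statements; no Liouville theorem) -/

/-- **Kill (DJ)** — no nonzero element of `𝒦` has time-disjoint supports at ratio `1+θ`: if at every point and
every instant `W((1+θ)t, y) = 0 ∨ W(t, y) = 0`, then `W ≡ 0` on the open past. -/
theorem eq_zero_of_disjointTimes {C θ : ℝ} {W : ℝ → E3 → E3} (hW : IsTypeIAncientMild C W) (hθ : 0 < θ)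
    (h : ∀ t < 0, ∀ y : E3, W ((1 + θ) * t) y = 0 ∨ W t y = 0) : ∀ t < 0, ∀ y : E3, W t y = 0 := by
  have hκ : 0 < 1 + θ := by linarith
  intro t ht y
  by_contra hne
  have hc : ContinuousAt (fun r : ℝ => W (1 * r) y) t := continuousAt_signal hW y one_pos ht
  simp only [one_mul] at hc
  have hev1 : ∀ᶠ s in 𝓝 t, W s y ≠ 0 := hc.eventually_ne hne
  have hev2 : ∀ᶠ s in 𝓝 t, s < 0 := Iio_mem_nhds ht
  have hzero : ∀ᶠ s in 𝓝 t, W ((1 + θ) * s) y = 0 := by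
    filter_upwards [hev1, hev2] with s hs hs0
    exact (h s hs0 y).resolve_right hs
  exact hne (signal_eq_zero_of_eventually hW y hκ ht hzero t ht)

/-- **Kill (GL)** — late-anchored forward contraction ⇒ `W ≡ 0`. -/
theorem eq_zero_of_lateGrowth {C θ q : ℝ} {W : ℝ → E3 → E3} (hW : IsTypeIAncientMild C W) (hθ : 0 < θ)
    (hq : q < 1)
    (h : ∀ t < 0, ∀ y : E3, W t y ≠ 0 → Real.sqrt (1 + θ) * ‖W ((1 + θ) * t) y‖ ≤ q * ‖W t y‖) :
    ∀ t < 0, ∀ y : E3, W t y = 0 := by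
  have hκ : 0 < 1 + θ := by linarith
  intro t ht y
  refine signal_eq_zero_of_forwardContraction hW hθ hq y ?_ t ht
  have hG := forall_nonneg_of_anchored hW y one_pos
    (G := fun s => q * ‖W s y‖ - Real.sqrt (1 + θ) * ‖W ((1 + θ) * s) y‖)
    (fun s hs => by
      have h1 : ContinuousAt (fun r : ℝ => W (1 * r) y) s := continuousAt_signal hW y one_pos hs
      simp only [one_mul] at h1
      have h2 := continuousAt_signal hW y hκ hs
      exact (h1.norm.const_mul q).sub (h2.norm.const_mul _))
    (fun s hs hne => by
      rw [one_mul] at hne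
      exact sub_nonneg.2 (h s hs y hne))
    (fun hz s hs => by
      have hks : (1 + θ) * s < 0 := mul_neg_of_pos_of_neg hκ hs
      simp only [hz s hs, hz _ hks, norm_zero, mul_zero, sub_zero, le_refl])
  intro s hs
  exact sub_nonneg.1 (hG s hs)

/-- **Kill (GE)** — early-anchored forward contraction ⇒ `W ≡ 0`. -/
theorem eq_zero_of_earlyGrowth {C θ q : ℝ} {W : ℝ → E3 → E3} (hW : IsTypeIAncientMild C W) (hθ : 0 < θ)
    (hq : q < 1)
    (h : ∀ t < 0, ∀ y : E3, W ((1 + θ) * t) y ≠ 0 →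
      Real.sqrt (1 + θ) * ‖W ((1 + θ) * t) y‖ ≤ q * ‖W t y‖) :
    ∀ t < 0, ∀ y : E3, W t y = 0 := by
  have hκ : 0 < 1 + θ := by linarith
  intro t ht y
  refine signal_eq_zero_of_forwardContraction hW hθ hq y ?_ t ht
  have hG := forall_nonneg_of_anchored hW y hκ
    (G := fun s => q * ‖W s y‖ - Real.sqrt (1 + θ) * ‖W ((1 + θ) * s) y‖)
    (fun s hs => by
      have h1 : ContinuousAt (fun r : ℝ => W (1 * r) y) s := continuousAt_signal hW y one_pos hs
      simp only [one_mul] at h1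
      have h2 := continuousAt_signal hW y hκ hs
      exact (h1.norm.const_mul q).sub (h2.norm.const_mul _))
    (fun s hs hne => sub_nonneg.2 (h s hs y hne))
    (fun hz s hs => by
      have hks : (1 + θ) * s < 0 := mul_neg_of_pos_of_neg hκ hs
      simp only [hz s hs, hz _ hks, norm_zero, mul_zero, sub_zero, le_refl])
  intro s hs
  exact sub_nonneg.1 (hG s hs)

/-- **Kill (DE)** — early-anchored backward escalation ⇒ `W ≡ 0`. -/
theorem eq_zero_of_earlyDecay {C θ q : ℝ} {W : ℝ → E3 → E3} (hW : IsTypeIAncientMild C W) (hθ : 0 < θ)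
    (hq : q < 1)
    (h : ∀ t < 0, ∀ y : E3, W ((1 + θ) * t) y ≠ 0 →
      ‖W t y‖ ≤ q * Real.sqrt (1 + θ) * ‖W ((1 + θ) * t) y‖) :
    ∀ t < 0, ∀ y : E3, W t y = 0 := by
  have hκ : 0 < 1 + θ := by linarith
  intro t ht y
  refine signal_eq_zero_of_backwardEscalation hW hθ hq y ?_ t ht
  have hG := forall_nonneg_of_anchored hW y hκ
    (G := fun s => q * Real.sqrt (1 + θ) * ‖W ((1 + θ) * s) y‖ - ‖W s y‖)
    (fun s hs => by
      have h1 : ContinuousAt (fun r : ℝ => W (1 * r) y) s := continuousAt_signal hW y one_pos hs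
      simp only [one_mul] at h1
      have h2 := continuousAt_signal hW y hκ hs
      exact (h2.norm.const_mul _).sub h1.norm)
    (fun s hs hne => sub_nonneg.2 (h s hs y hne))
    (fun hz s hs => by
      have hks : (1 + θ) * s < 0 := mul_neg_of_pos_of_neg hκ hs
      simp only [hz s hs, hz _ hks, norm_zero, mul_zero, sub_zero, le_refl])
  intro s hs
  exact sub_nonneg.1 (hG s hs)

end Summit.NavierStokesRegularity.NavierStokesRegularity.Theorems.ScenarioCensus.TwoTimeTop

end
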